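import Mathlib.AlgebraicGeometry.Normalization
import Mathlib.AlgebraicGeometry.ResidueField
import Mathlib.AlgebraicGeometry.Morphisms.Flat
import Mathlib.GroupTheory.Sylow
import HarnessLib

/-!
# Inertia groups of a finite group acting on a scheme; Abbes–Saito's property (NpS)

Topic: `Literature/AlgebraicGeometry/Ramification`. Abbes–Saito, *Ramification and cleanliness*
(Tohoku Math. J. 63 (2011) = arXiv:1007.3873v3, whose numbering we use), §2:

> **2.4.** Let `X` be a normal and locally noetherian scheme, `U` a dense open subscheme of `X`,
> `V` a Galois torsor over `U` of group `G`, and `Y` the integral closure of `X` in `V`. Then `G`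
> acts on `Y` and we have `X = Y/G`. Let `y` be a point of `Y` and `ȳ` a geometric point of `Y`
> above `y`. Recall that the inertia group `I_y` of `y` is the subgroup of elements `σ ∈ G` such
> that `σ(y) = y` and that `σ` acts trivially on `κ(y)`. It is convenient to denote `I_y` also
> by `I_ȳ` and to call it also the inertia group of `ȳ`.
>
> **Definition 2.12.** Let `X` be a locally noetherian and normal scheme, `U` a dense open
> subscheme of `X`, `V` a Galois torsor over `U` of group `G`, `Y` the integral closure of `X`
> in `V`, and `x̄` a geometric point of `X`. We say that `V/U` has the property **(NpS)** at `x̄`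
> if for every geometric point `ȳ` of `Y` above `x̄`, the inertia group `I_ȳ` of `ȳ` has a
> normal `p`-Sylow subgroup (or equivalently, `I_ȳ` is a semi-direct product of a group of order
> prime to `p` by a `p`-group ([Serre, *Corps locaux*] IV Thm 4.10)).

Here `p` is the prime number FIXED in AS2011 §2.1 (the characteristic of the perfect ground
field `k` of the paper); for schemes over a field of characteristic `p` — the only case in which
the paper uses the notion (§7: 7.19, 7.22) and the case of the consumers (route CleanCovers of
ResolutionOfSingularities) — it is the residue characteristic at every point.

## Content (namespace `Literature.AlgebraicGeometry.Ramification`)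

* `HasNormalSylow p G` — the group-theoretic core: `G` has a normal Sylow `p`-subgroup; API:
  uniqueness, `p`-groups / prime-to-`p` groups / normal `p`-subgroups of index prime to `p`
  (inertia of a dvr: Serre IV §2 Cor. 4), inheritance by SUBGROUPS (Bourbaki *Alg.* I §6.6
  Cor. 3 of Thm 3 — the input of AS2011 Cor. 2.14, Lemma 2.15) and QUOTIENTS (input of 2.21).
* `inertiaSubgroup σ y` — for any action `σ : G →* Aut Y` on a scheme: AS2011 2.4's inertia
  group of the point `y`, rendered as the stabiliser of the canonical point `Spec κ(y) → Y`; `mem_inertiaSubgroup_iff_residueFieldMap` is the printed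
  form "`g y = y` and `g` acts trivially on `κ(y)`", `mem_inertiaSubgroup_iff_comp_eq` is
  AS2011's `I_ȳ = I_y` (the stabiliser of every `K`-point localised at `y`). On an affine
  `G`-scheme `Spec B` this is Mathlib's `Ideal.inertia G 𝔭` (not re-proved here).
* `normalizationAut`, `normalizationAction` — AS2011 2.4 "`G` acts on `Y`": automorphisms of `V`
  over `X` extend uniquely to Mathlib's relative normalization `f.normalization` (Stacks 035H,
  `Scheme.Hom.normalizationDesc` / `normalization.hom_ext`).
* `InertiaNormalSylowAt p f ρ hρ x`, `InertiaNormalSylow p f ρ hρ` — **Def. 2.12, (NpS)** at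
  `x ∈ X` / everywhere, for `f : V → X` (in the paper `V → U ⊆ X`) with an action `ρ` of `G` on
  `V` over `X`. Geometric points `x̄`, `ȳ` are replaced by the points `x`, `y` they localise at:
  `I_ȳ = I_y` (2.4), and as `Y → X` is integral every point `y` above `x` underlies a geometric
  point above `x̄`; so this is exactly the printed condition.

The hypotheses of the SETTING (`X` normal, `U` dense, `V → U` a Galois torsor) are not needed
to STATE the definition; they belong to the theorems about it (companion file
`InertiaNormalSylowBlowup.lean`: AS2011 Prop. 2.22 as a named fact). NOT here: Lemma 2.13 /
Cor. 2.14 (openness of the (NpS) locus), Lemma 2.15 (base change) — their proofs use strict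
localisations (SGA 4 VIII 7.5), absent from Mathlib; only their group-theoretic inputs are here.

## References

* A. Abbes, T. Saito, *Ramification and cleanliness*, Tohoku Math. J. (2) 63 (2011), 775–853,
  §2: 2.1, 2.3, 2.4, Def. 2.12, Cor. 2.14, Lemma 2.15, Prop. 2.22 (= arXiv:1007.3873v3).
  [AbbesSaito2011]
* J.-P. Serre, *Local Fields*, GTM 67, Ch. IV §2, Cor. 4 of Prop. 7. [Serre1979]
* The Stacks Project, Tag 035H (relative normalization). [StacksProject]
-/

noncomputable section

open CategoryTheory CategoryTheory.Limits AlgebraicGeometry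

namespace Literature.AlgebraicGeometry.Ramification

universe u

/-! ## Finite groups with a normal Sylow `p`-subgroup -/

section GroupTheory

/-- `HasNormalSylow p G`: the group `G` **has a normal Sylow `p`-subgroup** — the condition on
inertia groups in Abbes–Saito's property (NpS); for a finite group and a prime `p` it says that
the Sylow `p`-subgroup is unique, equivalently (Schur–Zassenhaus) that `G` is a semi-direct
product of a group of order prime to `p` by a normal `p`-group.
[cite: AbbesSaito2011, Def. 2.12] -/
def HasNormalSylow (p : ℕ) (G : Type*) [Group G] : Prop :=
  ∃ P : Sylow p G, (P : Subgroup G).Normal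

variable {p : ℕ} {G : Type*} [Group G]

/-- If some Sylow `p`-subgroup is normal, it is the only Sylow `p`-subgroup. [folklore] -/
theorem HasNormalSylow.subsingleton [Fact p.Prime] [Finite (Sylow p G)] (h : HasNormalSylow p G) :
    Subsingleton (Sylow p G) := by
  obtain ⟨P, hP⟩ := h
  haveI := Sylow.unique_of_normal P hP
  infer_instance

/-- If `G` has a normal Sylow `p`-subgroup then every Sylow `p`-subgroup of `G` is normal.
[folklore] -/
theorem HasNormalSylow.normal [Fact p.Prime] [Finite (Sylow p G)] (h : HasNormalSylow p G)
    (Q : Sylow p G) : (Q : Subgroup G).Normal :=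
  haveI := h.subsingleton
  Sylow.normal_of_subsingleton Q

/-- A group with a unique Sylow `p`-subgroup has a normal Sylow `p`-subgroup. [folklore] -/
theorem hasNormalSylow_of_subsingleton [Subsingleton (Sylow p G)] : HasNormalSylow p G :=
  ⟨default, Sylow.normal_of_subsingleton _⟩

/-- For a prime `p` (and finitely many Sylow `p`-subgroups, e.g. `G` finite): `G` has a normal
Sylow `p`-subgroup iff its Sylow `p`-subgroup is unique. [folklore] -/
theorem hasNormalSylow_iff_subsingleton [Fact p.Prime] [Finite (Sylow p G)] :
    HasNormalSylow p G ↔ Subsingleton (Sylow p G) :=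
  ⟨HasNormalSylow.subsingleton, fun _ => hasNormalSylow_of_subsingleton⟩

/-- A normal `p`-subgroup of index prime to `p` is a normal Sylow `p`-subgroup; this is the shape
"`p`-group by (cyclic) prime-to-`p`" of the inertia group of a Galois extension of discrete
valuation rings (Serre, *Local Fields* IV §2, Cor. 4 of Prop. 7), whence (NpS) at points of
codimension one. [cite: Serre1979, Ch. IV §2 Cor. 4] -/
theorem HasNormalSylow.of_normal_of_not_dvd_index [Fact p.Prime] (N : Subgroup G) [hN : N.Normal]
    (hpN : IsPGroup p N) (hi : ¬p ∣ N.index) : HasNormalSylow p G :=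
  ⟨hpN.toSylow hi, hN⟩

/-- A `p`-group has a normal Sylow `p`-subgroup (itself). [folklore] -/
theorem HasNormalSylow.of_isPGroup [Fact p.Prime] (h : IsPGroup p G) : HasNormalSylow p G :=
  HasNormalSylow.of_normal_of_not_dvd_index ⊤ (h.to_subgroup ⊤)
    (by rw [Subgroup.index_top]; exact (Fact.out : p.Prime).not_dvd_one)

/-- A finite group of order prime to `p` has a normal Sylow `p`-subgroup (the trivial one).
[folklore] -/
theorem HasNormalSylow.of_not_dvd_card [Fact p.Prime] [Finite G] (h : ¬p ∣ Nat.card G) :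
    HasNormalSylow p G :=
  HasNormalSylow.of_normal_of_not_dvd_index ⊥ IsPGroup.of_bot (by rwa [Subgroup.index_bot])

/-- **Subgroups inherit a normal Sylow `p`-subgroup** (Bourbaki, *Algèbre* I §6.6, Cor. 3 of
Thm 3; the group-theoretic input of AS2011 Cor. 2.14 and Lemma 2.15): if the finite group `G` has
a normal Sylow `p`-subgroup `P`, then `P ∩ H` is a normal Sylow `p`-subgroup of any subgroup `H`.
[cite: AbbesSaito2011, proof of Cor. 2.14] -/
theorem HasNormalSylow.subgroup [Fact p.Prime] [Finite G] (h : HasNormalSylow p G)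
    (H : Subgroup G) : HasNormalSylow p H := by
  obtain ⟨P, hP⟩ := h
  haveI := hP
  refine HasNormalSylow.of_normal_of_not_dvd_index ((P : Subgroup G).subgroupOf H)
    P.isPGroup'.comap_subtype fun hdvd => P.not_dvd_index ?_
  exact hdvd.trans (Subgroup.relIndex_dvd_index_of_normal (P : Subgroup G) H)

/-- **Quotients inherit a normal Sylow `p`-subgroup** (the input of AS2011 Lemma 2.21: an
inertia group which is a quotient of a group with a normal `p`-Sylow has one). [folklore] -/
theorem HasNormalSylow.of_surjective [Fact p.Prime] [Finite G] {G' : Type*} [Group G']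
    (h : HasNormalSylow p G) (φ : G →* G') (hφ : Function.Surjective φ) : HasNormalSylow p G' := by
  obtain ⟨P, hP⟩ := h
  exact ⟨P.mapSurjective hφ, by simpa using hP.map φ hφ⟩

end GroupTheory

/-! ## Automorphism groups in a category: unfolding lemmas -/

section Aut

variable {C : Type*} [Category C] {Z : C}

/-- The unit of `Aut Z` is the identity. [folklore] -/
@[simp] theorem aut_one_hom : (1 : Aut Z).hom = 𝟙 Z := rfl
/-- Multiplication in `Aut Z` is composition in the `Function.comp` order. [folklore] -/
@[simp] theorem aut_mul_hom (a b : Aut Z) : (a * b).hom = b.hom ≫ a.hom := rfl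
/-- Inversion in `Aut Z`. [folklore] -/
@[simp] theorem aut_inv_hom (a : Aut Z) : a⁻¹.hom = a.inv := rfl

end Aut

/-! ## Inertia subgroups of a point under a group action on a scheme -/

section Inertia

variable {G : Type*} [Group G] {Y : Scheme.{u}} (σ : G →* Aut Y)

/-- The **inertia subgroup** `I_y ⊆ G` of a point `y` of a scheme `Y` under an action `σ` of `G`
by automorphisms (AS2011 2.4): the elements `g` with `g(y) = y` acting trivially on the residue
field `κ(y)` — equivalently (`mem_inertiaSubgroup_iff_residueFieldMap`) the stabiliser of the
canonical point `Spec κ(y) → Y`, which is the form used here. [cite: AbbesSaito2011, 2.4] -/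
def inertiaSubgroup (y : Y) : Subgroup G where
  carrier := {g | Y.fromSpecResidueField y ≫ (σ g).hom = Y.fromSpecResidueField y}
  one_mem' := by simp
  mul_mem' {a b} ha hb := by
    simp only [Set.mem_setOf_eq, map_mul, aut_mul_hom] at *
    rw [← Category.assoc, hb, ha]
  inv_mem' {a} ha := by
    simp only [Set.mem_setOf_eq, map_inv, aut_inv_hom] at *
    rw [Iso.comp_inv_eq, ha]

/-- Unfolding of `inertiaSubgroup`: `g ∈ I_y` iff `g` fixes the canonical point
`Spec κ(y) → Y`. [folklore] -/
theorem mem_inertiaSubgroup_iff {y : Y} {g : G} :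
    g ∈ inertiaSubgroup σ y ↔
      Y.fromSpecResidueField y ≫ (σ g).hom = Y.fromSpecResidueField y :=
  Iff.rfl

/-- An element of the inertia group of `y` fixes `y`. [folklore] -/
theorem apply_eq_of_mem_inertiaSubgroup {y : Y} {g : G} (hg : g ∈ inertiaSubgroup σ y) :
    (σ g).hom y = y :=
  calc (σ g).hom y = (Y.fromSpecResidueField y ≫ (σ g).hom) default := by
          rw [Scheme.Hom.comp_apply, Scheme.fromSpecResidueField_apply]
    _ = y := by rw [hg, Scheme.fromSpecResidueField_apply]

/-- **The printed form of the inertia group** (AS2011 2.4): `g ∈ I_y` iff `g(y) = y` and the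
automorphism of `κ(y)` induced by `g` is the identity (i.e. equals the canonical identification
`κ(g y) = κ(y)`). [cite: AbbesSaito2011, 2.4] -/
theorem mem_inertiaSubgroup_iff_residueFieldMap {y : Y} {g : G} :
    g ∈ inertiaSubgroup σ y ↔
      ∃ h : (σ g).hom y = y, (σ g).hom.residueFieldMap y = (Y.residueFieldCongr h).hom := by
  constructor
  · intro hg
    have h : (σ g).hom y = y := apply_eq_of_mem_inertiaSubgroup σ hg
    refine ⟨h, ?_⟩
    rw [mem_inertiaSubgroup_iff, ← Scheme.Hom.SpecMap_residueFieldMap_fromSpecResidueField,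
      ← Scheme.residueFieldCongr_fromSpecResidueField h,
      cancel_mono (Y.fromSpecResidueField _)] at hg
    exact Spec.map_injective hg
  · rintro ⟨h, hh⟩
    rw [mem_inertiaSubgroup_iff, ← Scheme.Hom.SpecMap_residueFieldMap_fromSpecResidueField, hh,
      Scheme.residueFieldCongr_fromSpecResidueField]

/-- For a point `y` and a non-zero ring `S`, `Spec S → Spec κ(y)` is an epimorphism of schemes
(flat, as `κ(y)` is a field, and surjective onto the point). [folklore] -/
theorem epi_SpecMap_residueField (y : Y) {S : CommRingCat.{u}} [Nontrivial S]
    (φ : Y.residueField y ⟶ S) : Epi (Spec.map φ) := by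
  have : Flat (Spec.map φ) :=
    HasRingHomProperty.Spec_iff.mpr (RingHom.Flat.of_isField (Field.toIsField _) _)
  have : Surjective (Spec.map φ) :=
    ⟨fun x => ⟨Classical.arbitrary _, Subsingleton.elim _ _⟩⟩
  exact Flat.epi_of_flat_of_surjective _

/-- **`I_ȳ = I_y`** (AS2011 2.4: "it is convenient to denote `I_y` also by `I_ȳ`"): for every
field `K` and every `K`-point `ȳ : Spec K → Y` localised at `y` — in particular every geometric
point above `y` — the inertia group of `y` is the stabiliser of `ȳ` in `G`. [cite: AbbesSaito2011, 2.4] -/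
theorem mem_inertiaSubgroup_iff_comp_eq {K : Type u} [Field K] (pt : Spec (.of K) ⟶ Y) (g : G) :
    g ∈ inertiaSubgroup σ (pt (IsLocalRing.closedPoint K)) ↔ pt ≫ (σ g).hom = pt := by
  have hpt := Scheme.descResidueField_stalkClosedPointTo_fromSpecResidueField K Y pt
  rw [mem_inertiaSubgroup_iff]
  constructor
  · intro hg
    conv_lhs => rw [← hpt]
    rw [Category.assoc, hg, hpt]
  · intro hg
    haveI := epi_SpecMap_residueField (Y := Y) (pt (IsLocalRing.closedPoint K))
      (Y.descResidueField (Scheme.stalkClosedPointTo pt))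
    rw [← cancel_epi (Spec.map (Y.descResidueField (Scheme.stalkClosedPointTo pt))),
      ← Category.assoc, hpt, hg]

end Inertia

/-! ## The action on the relative normalization (AS2011 2.4: "`G` acts on `Y`") -/

section Normalization

variable {G : Type*} [Group G] {V X : Scheme.{u}} (f : V ⟶ X) [QuasiCompact f] [QuasiSeparated f]

/-- `f` factors as `V —g→ V → Y → X` for an automorphism `g` of `V` over `X`. [folklore] -/
theorem eq_hom_comp_toNormalization_comp (g : Aut V) (hg : g.hom ≫ f = f) :
    f = (g.hom ≫ f.toNormalization) ≫ f.fromNormalization := by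
  rw [Category.assoc, Scheme.Hom.toNormalization_fromNormalization, hg]

omit [QuasiCompact f] [QuasiSeparated f] in
/-- The inverse of an automorphism over `X` is over `X`. [folklore] -/
theorem inv_hom_comp_eq (g : Aut V) (hg : g.hom ≫ f = f) : g.inv ≫ f = f :=
  (Iso.inv_comp_eq (show V ≅ V from g)).mpr hg.symm

/-- An automorphism `g` of `V` **over `X`** (`g ≫ f = f`) extends uniquely to an automorphism of
the relative normalization `Y = f.normalization` of `X` in `V` compatible with `V → Y → X`
(universal property of the relative normalization, Stacks 035I; AS2011 2.4 "`G` acts on `Y`").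
[cite: StacksProject, Tag 035I] -/
def normalizationAut (g : Aut V) (hg : g.hom ≫ f = f) : Aut f.normalization where
  hom := f.normalizationDesc (g.hom ≫ f.toNormalization) f.fromNormalization
    (eq_hom_comp_toNormalization_comp f g hg)
  inv := f.normalizationDesc (g.inv ≫ f.toNormalization) f.fromNormalization
    (eq_hom_comp_toNormalization_comp f g⁻¹ (inv_hom_comp_eq f g hg))
  hom_inv_id := by
    apply Scheme.Hom.normalization.hom_ext f _ _ f.fromNormalization <;> simp
  inv_hom_id := by
    apply Scheme.Hom.normalization.hom_ext f _ _ f.fromNormalization <;> simp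

/-- `V → Y` intertwines `g` and its extension. [folklore] -/
@[reassoc (attr := simp)]
theorem toNormalization_normalizationAut_hom (g : Aut V) (hg : g.hom ≫ f = f) :
    f.toNormalization ≫ (normalizationAut f g hg).hom = g.hom ≫ f.toNormalization :=
  Scheme.Hom.toNormalization_normalizationDesc f _ _ (eq_hom_comp_toNormalization_comp f g hg)

/-- The extension is an automorphism over `X`. [folklore] -/
@[reassoc (attr := simp)]
theorem normalizationAut_hom_fromNormalization (g : Aut V) (hg : g.hom ≫ f = f) :
    (normalizationAut f g hg).hom ≫ f.fromNormalization = f.fromNormalization :=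
  Scheme.Hom.normalizationDesc_comp f _ _ (eq_hom_comp_toNormalization_comp f g hg)

/-- Uniqueness of the extension: an endomorphism of `Y` over `X` intertwined with `g` by `V → Y`
is the extension of `g`. [folklore] -/
theorem normalizationAut_unique (g : Aut V) (hg : g.hom ≫ f = f)
    (φ : f.normalization ⟶ f.normalization)
    (h₁ : f.toNormalization ≫ φ = g.hom ≫ f.toNormalization)
    (h₂ : φ ≫ f.fromNormalization = f.fromNormalization) : φ = (normalizationAut f g hg).hom :=
  Scheme.Hom.normalization.hom_ext f _ _ f.fromNormalization (by rw [h₁]; simp) h₂ (by simp)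

/-- The identity of `V` extends to the identity of `Y`. [folklore] -/
@[simp] theorem normalizationAut_one (h : (1 : Aut V).hom ≫ f = f) : normalizationAut f 1 h = 1 :=
  Aut.ext (by
    rw [aut_one_hom]
    exact (normalizationAut_unique f 1 h (𝟙 _) (by simp) (by simp)).symm)

variable (ρ : G →* Aut V) (hρ : ∀ g, (ρ g).hom ≫ f = f)

/-- **`G` acts on the normalization** (AS2011 2.4): an action `ρ` of `G` on `V` by automorphisms
over `X` induces the action `g ↦ normalizationAut f (ρ g)` on the relative normalization
`Y = f.normalization` of `X` in `V`, by automorphisms over `X`. [cite: AbbesSaito2011, 2.4] -/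
def normalizationAction : G →* Aut f.normalization :=
  MonoidHom.mk' (fun g => normalizationAut f (ρ g) (hρ g)) fun a b => by
    ext
    apply Scheme.Hom.normalization.hom_ext f _ _ f.fromNormalization <;> simp

/-- Unfolding of `normalizationAction`. [folklore] -/
theorem normalizationAction_apply (g : G) :
    normalizationAction f ρ hρ g = normalizationAut f (ρ g) (hρ g) :=
  rfl

omit ρ hρ in
/-- The trivial action on `V` induces the trivial action on `Y`. [folklore] -/
@[simp] theorem normalizationAction_one (h : ∀ g : G, ((1 : G →* Aut V) g).hom ≫ f = f) :
    normalizationAction f (1 : G →* Aut V) h = 1 := by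
  ext g : 1
  exact normalizationAut_one f (h g)

/-- `V → Y` is `G`-equivariant. [folklore] -/
@[reassoc (attr := simp)]
theorem toNormalization_normalizationAction_hom (g : G) :
    f.toNormalization ≫ (normalizationAction f ρ hρ g).hom = (ρ g).hom ≫ f.toNormalization :=
  toNormalization_normalizationAut_hom f (ρ g) (hρ g)

/-- `G` acts on `Y` over `X`. [folklore] -/
@[reassoc (attr := simp)]
theorem normalizationAction_hom_fromNormalization (g : G) :
    (normalizationAction f ρ hρ g).hom ≫ f.fromNormalization = f.fromNormalization :=
  normalizationAut_hom_fromNormalization f (ρ g) (hρ g)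

end Normalization

/-! ## Abbes–Saito's property (NpS) (Definition 2.12) -/

section NpS

variable {G : Type*} [Group G] {V X : Scheme.{u}}

/-- **Property (NpS) at a point** (Abbes–Saito 2011, Def. 2.12). Data: a (qcqs) morphism
`f : V → X` — in the paper the composite of a Galois torsor `V → U` of group `G` with a dense
open immersion `U ⊆ X`, `X` normal locally noetherian — an action `ρ` of `G` on `V` over `X`
(`hρ`), and the prime `p` fixed in AS2011 §2.1. `V/U` **has the property (NpS) at `x ∈ X`** iff
for every point `y` above `x` of the integral closure `Y = f.normalization` of `X` in `V` (with
its `G`-action `normalizationAction`) the inertia group `I_y ⊆ G` has a normal Sylow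
`p`-subgroup. The paper quantifies over geometric points `ȳ` of `Y` above a geometric point `x̄`;
as `I_ȳ = I_y` (2.4, `mem_inertiaSubgroup_iff_comp_eq`) and every `y` above `x` underlies some
`ȳ` above `x̄` (`Y → X` is integral), this is the same condition. [cite: AbbesSaito2011, Def. 2.12] -/
def InertiaNormalSylowAt (p : ℕ) (f : V ⟶ X) [QuasiCompact f] [QuasiSeparated f] (ρ : G →* Aut V)
    (hρ : ∀ g, (ρ g).hom ≫ f = f) (x : X) : Prop :=
  ∀ y : ↥f.normalization, f.fromNormalization y = x →
    HasNormalSylow p (inertiaSubgroup (normalizationAction f ρ hρ) y)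

/-- **Property (NpS)** (Abbes–Saito 2011, Def. 2.12 at every geometric point, as in Cor. 2.14,
Prop. 2.22 and Prop. 7.19 (i)): `V/U` has (NpS) at every point of `X`, i.e. EVERY inertia group
`I_y ⊆ G`, `y` a point of the integral closure `Y` of `X` in `V`, has a normal Sylow
`p`-subgroup. [cite: AbbesSaito2011, Def. 2.12] -/
def InertiaNormalSylow (p : ℕ) (f : V ⟶ X) [QuasiCompact f] [QuasiSeparated f] (ρ : G →* Aut V)
    (hρ : ∀ g, (ρ g).hom ≫ f = f) : Prop :=
  ∀ x : X, InertiaNormalSylowAt p f ρ hρ x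

variable {p : ℕ} {f : V ⟶ X} [QuasiCompact f] [QuasiSeparated f] {ρ : G →* Aut V}
  {hρ : ∀ g, (ρ g).hom ≫ f = f}

/-- (NpS) everywhere says: every inertia group of the action of `G` on `Y` has a normal Sylow
`p`-subgroup. [folklore] -/
theorem inertiaNormalSylow_iff_forall :
    InertiaNormalSylow p f ρ hρ ↔
      ∀ y : ↥f.normalization, HasNormalSylow p (inertiaSubgroup (normalizationAction f ρ hρ) y) :=
  ⟨fun h y => h _ y rfl, fun h _ y _ => h y⟩

/-- If `G` itself has a normal Sylow `p`-subgroup then `V/U` has (NpS) everywhere, inertia groups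
being subgroups of `G` (AS2011, proof of Prop. 7.19: "we may assume that `G` has a normal `p`-Sylow
subgroup"). [cite: AbbesSaito2011, Prop. 7.19] -/
theorem InertiaNormalSylow.of_hasNormalSylow [Fact p.Prime] [Finite G] (hG : HasNormalSylow p G) :
    InertiaNormalSylow p f ρ hρ :=
  fun _ _ _ => hG.subgroup _

/-- A `p`-group `G` (e.g. an Artin–Schreier–Witt cover) gives (NpS) everywhere. [folklore] -/
theorem InertiaNormalSylow.of_isPGroup [Fact p.Prime] [Finite G] (hG : IsPGroup p G) :
    InertiaNormalSylow p f ρ hρ :=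
  InertiaNormalSylow.of_hasNormalSylow (HasNormalSylow.of_isPGroup hG)

/-- A group of order prime to `p` (a tame cover) gives (NpS) everywhere. [folklore] -/
theorem InertiaNormalSylow.of_not_dvd_card [Fact p.Prime] [Finite G] (hG : ¬p ∣ Nat.card G) :
    InertiaNormalSylow p f ρ hρ :=
  InertiaNormalSylow.of_hasNormalSylow (HasNormalSylow.of_not_dvd_card hG)

end NpS

end Literature.AlgebraicGeometry.Ramification

end
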